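import Summits.ResolutionOfSingularities.ResolutionOfSingularities.Theorems.PurelyInseparableDim4EquimultipleOffCentre
import Summits.ResolutionOfSingularities.ResolutionOfSingularities.Theorems.PurelyInseparableDim4FirstStep
import Literature.AlgebraicGeometry.Resolution.BlowupSequences
import HarnessLib

/-!
# Purely inseparable four-folds: ONE-STEP ORDER REDUCTION — if the walk has no edge out of the root and the
# order-`p` locus lies on the centre, one permissible blow-up is a marked resolution (brick TY-3i, cell `res-dim4-pi`)

[OURS · counted 0] (D-0157 DOOR 2; the depth-one case of the frame `PIDim4.TerminationImpliesOrderReduction`,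
assembled end-to-end from typ-2's TY-2 (a)–(f) (`ChartDictionary.*`, `FirstStep`) and typ-3's TY-3–TY-3h
(`Equimultiple.*`); host item stmt-ResolutionOfSingularities-16155, helper). Resolution of singularities in
dimension ≥ 4 / characteristic `p` is NOT proved here or anywhere in this programme: this is the trivial-depth case of
OUR candidate frame, typed so that the engines' «TERMINATED after one blow-up» rows have a theorem to instantiate.

**Theorem** (`isMarkedResolution_transform_of_no_edge`). `K` algebraically closed of characteristic `p`, `F ≠ 0` clean,
`V(z, x_S)` a Hironaka-permissible coordinate centre of `z^p + F`, `π : W → 𝔸⁵_K` ANY blowing up along it. Suppose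
(1) the walk has NO EDGE out of the state `s` (no chart `j ∈ S` has an equimultiple point `b` on its exceptional
hyperplane: `∀ s', ¬ PIDim4.Edge p S s s'`), and (2) every closed order-`p` point `(a, b)` of `V(z^p + F)` lies on the
centre (`a^p + F(b) = 0 ∧ (D^{(α)}F)(b) = 0 (0 < |α| < p) ⇒ b_i = 0 (i ∈ S)`). Then the transformed marked ideal has
empty support (`support_transform_eq_empty_of_no_edge`, by TY-3h's case split + TY-3g's closed-point criterion), so
`π` is a marked resolution of `(𝔸⁵_K, (z^p + F)·𝒪, [], p)` (typ-2's `isMarkedResolution_single_of_support_eq_empty`),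
and the conclusion of `PIDim4.OrderReduction p` holds FOR THIS `F` (`exists_isMarkedResolution_of_no_edge`, with the
tree's `blowup.π`).

* `eval_eq_zero_of_one_le_ordAlong` — `F ∈ (x_S) ⇒ F(b) = 0` when `b_S = 0`;
* `mem_CΛ_of_cons` — the rational point `(0, b)` with `b_S = 0` lies on `V(z, x_S)`;
* `support_transform_eq_empty_of_no_edge`, `isMarkedResolution_transform_of_no_edge`,
  `exists_isMarkedResolution_of_no_edge`; conversely `support_transform_nonempty_of_edge` (an edge leaves a point of
  order `p` upstairs, so one blow-up is then NOT a marked resolution).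

AI-produced formalisation, weaker than expert review. bears_on: LADDER-RESOLUTION:D157-DOOR2 (res-dim4-pi · TY-3i).
-/

set_option linter.dupNamespace false -- D-0017: single-problem summit path `Summit.<S>.<S>.…` by design

noncomputable section

open MvPolynomial Finset CategoryTheory AlgebraicGeometry Opposite

namespace Summit.ResolutionOfSingularities.ResolutionOfSingularities.Theorems.PIDim4

open Literature.AlgebraicGeometry.Resolution
open Literature.AlgebraicGeometry.Resolution.Hauser2010
open Literature.AlgebraicGeometry.Resolution.AffinePointBlowup (P A γ coord Wtop)

namespace Equimultiple

section OneStep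

variable {K : Type} [Field K] {p : ℕ} [hp : Fact p.Prime] [CharP K p] [DecidableEq K]
variable {S : Finset (Fin 4)} {W : Scheme.{0}} {π : W ⟶ P 4 K}

omit hp [CharP K p] [DecidableEq K] in
/-- `F ∈ (xᵢ : i ∈ S)` (`1 ≤ ord_{(x_S)} F`) vanishes at every point with `b_S = 0`. [folklore] -/
theorem eval_eq_zero_of_one_le_ordAlong {F : MvPolynomial (Fin 4) K} (h : (1 : ℕ∞) ≤ CentreBlowup.ordAlong S F)
    {b : Fin 4 → K} (hb : ∀ i ∈ S, b i = 0) : MvPolynomial.eval b F = 0 := by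
  classical
  conv_lhs => rw [F.as_sum]
  rw [map_sum]
  refine Finset.sum_eq_zero fun d hd => ?_
  have h1 : 1 ≤ CentreBlowup.degIn S d := by
    have h' : CentreBlowup.ordAlong S F ≤ (CentreBlowup.degIn S d : ℕ∞) := Finset.inf_le hd
    exact_mod_cast h.trans h'
  obtain ⟨i, hiS, hi⟩ : ∃ i ∈ S, d i ≠ 0 := by
    by_contra hall
    push Not at hall
    have : CentreBlowup.degIn S d = 0 := Finset.sum_eq_zero hall
    omega
  rw [eval_monomial, Finsupp.prod, Finset.prod_eq_zero (Finsupp.mem_support_iff.mpr hi)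
    (by rw [hb i hiS, zero_pow hi]), mul_zero]

omit hp [CharP K p] [DecidableEq K] in
/-- The rational point `(0, b)` with `bᵢ = 0` for `i ∈ S` lies on the centre `V(z, x_S)`.
[cite: HauserPerlega2019PRIMS, §2 (the centre P = (z, xᵢ : i ∈ Γ))] -/
theorem mem_CΛ_of_cons {x : P 4 K} {a : K} {b : Fin 4 → K}
    (hx : x.asIdeal = MvPolynomial.vanishingIdeal K {(Fin.cons a b : Fin (4 + 1) → K)}) (ha : a = 0)
    (hb : ∀ i ∈ S, b i = 0) : x ∈ AffineCoordBlowup.CΛ 4 K (insert 0 (Fin.succ '' (S : Set (Fin 4)))) := by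
  rw [AffineCoordBlowup.mem_CΛ_iff']
  intro i hi
  rcases Set.mem_insert_iff.mp hi with h0 | ⟨j, hj, rfl⟩
  · subst h0
    rw [hx, MvPolynomial.mem_vanishingIdeal_singleton_iff, aeval_X, Fin.cons_zero]
    exact ha
  · exact (X_succ_mem_asIdeal_iff j a b hx).mpr (hb j hj)

/-- **No edge and no order-`p` point off the centre ⇒ the transform has empty support.** [cite: Hauser2010, §F]
[cite: BierstoneGrigorievMilmanWlodarczyk2011, Def. 3.1.3 (6)] -/
theorem support_transform_eq_empty_of_no_edge [IsAlgClosed K] (s : State K) (hF : s.F ≠ 0)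
    (hclean : Literature.Barriers.ResolutionOfSingularities.HauserPerlega.IsClean p s.F)
    (hS : IsPermissibleCentre p S s.F)
    (hπ : IsBlowup π (AffineCoordBlowup.𝓘Λ 4 K (insert 0 (Fin.succ '' (S : Set (Fin 4))))))
    (hnoEdge : ∀ s' : State K, ¬ Edge p S s s')
    (hlocus : ∀ (a : K) (b : Fin 4 → K), a ^ p + MvPolynomial.eval b s.F = 0 →
      (∀ α : Fin 4 →₀ ℕ, α ≠ 0 → α.degree < p → MvPolynomial.eval b (hasseDeriv K α s.F) = 0) →
        ∀ i ∈ S, b i = 0) :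
    ((⟨hypSheaf p s.F, [], p⟩ : MarkedIdeal (P 4 K)).transform π
        (AffineCoordBlowup.𝓘Λ 4 K (insert 0 (Fin.succ '' (S : Set (Fin 4)))))).support = ∅ := by
  rw [support_transform_eq_empty_iff s.F [] hπ]
  intro w hw
  by_contra hge
  rw [not_lt] at hge
  rcases closedSupport_transform_cases s hF hclean hS hπ hw hge with
    ⟨j, hj, x, a, b, -, -, -, hedge⟩ | ⟨hwC, a, b, hab, hroot, hhasse⟩
  · exact hnoEdge _ hedge
  · have hbS : ∀ i ∈ S, b i = 0 := hlocus a b hroot hhasse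
    have hFb : MvPolynomial.eval b s.F = 0 :=
      eval_eq_zero_of_one_le_ordAlong (le_trans (by exact_mod_cast hp.out.one_lt.le) hS.2) hbS
    have ha : a = 0 := by
      rw [hFb, add_zero] at hroot
      exact pow_eq_zero_iff (hp.out.ne_zero) |>.mp hroot
    exact hwC (mem_CΛ_of_cons hab ha hbS)

/-- **ONE-STEP ORDER REDUCTION (depth-one case of the frame).** Under the hypotheses of
`support_transform_eq_empty_of_no_edge`, ANY blowing up of `𝔸⁵_K` along `V(z, x_S)` is a marked resolution of
`(𝔸⁵_K, (z^p + F)·𝒪, [], p)` (one admissible step, typ-2's `isMarkedResolution_single_of_support_eq_empty`).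
[cite: BierstoneGrigorievMilmanWlodarczyk2011, Def. 3.1.3] -/
theorem isMarkedResolution_transform_of_no_edge [IsAlgClosed K] (s : State K) (hF : s.F ≠ 0)
    (hclean : Literature.Barriers.ResolutionOfSingularities.HauserPerlega.IsClean p s.F)
    (hS : IsPermissibleCentre p S s.F)
    (hπ : IsBlowup π (AffineCoordBlowup.𝓘Λ 4 K (insert 0 (Fin.succ '' (S : Set (Fin 4))))))
    (hnoEdge : ∀ s' : State K, ¬ Edge p S s s')
    (hlocus : ∀ (a : K) (b : Fin 4 → K), a ^ p + MvPolynomial.eval b s.F = 0 →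
      (∀ α : Fin 4 →₀ ℕ, α ≠ 0 → α.degree < p → MvPolynomial.eval b (hasseDeriv K α s.F) = 0) →
        ∀ i ∈ S, b i = 0) :
    IsMarkedResolution (⟨hypSheaf p s.F, [], p⟩ : MarkedIdeal (P 4 K)) π
      ((⟨hypSheaf p s.F, [], p⟩ : MarkedIdeal (P 4 K)).transform π
        (AffineCoordBlowup.𝓘Λ 4 K (insert 0 (Fin.succ '' (S : Set (Fin 4)))))) :=
  ChartDictionary.isMarkedResolution_single_of_support_eq_empty p hS hπ
    (support_transform_eq_empty_of_no_edge s hF hclean hS hπ hnoEdge hlocus)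

/-- **The conclusion of `PIDim4.OrderReduction p` for such an `F`**: a marked resolution of
`(𝔸⁵_K, (z^p + F)·𝒪, [], p)` exists (take the tree's blow-up `blowup.π 𝓘Λ`). This does NOT prove `OrderReduction p`
(which quantifies over ALL clean `F ≠ 0`); it is the depth-one instance of the frame. [cite: Hironaka1964, Main Theorem I
(the characteristic-zero statement whose analogue is asked)] -/
theorem exists_isMarkedResolution_of_no_edge [IsAlgClosed K] (s : State K) (hF : s.F ≠ 0)
    (hclean : Literature.Barriers.ResolutionOfSingularities.HauserPerlega.IsClean p s.F)
    (hS : IsPermissibleCentre p S s.F) (hnoEdge : ∀ s' : State K, ¬ Edge p S s s')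
    (hlocus : ∀ (a : K) (b : Fin 4 → K), a ^ p + MvPolynomial.eval b s.F = 0 →
      (∀ α : Fin 4 →₀ ℕ, α ≠ 0 → α.degree < p → MvPolynomial.eval b (hasseDeriv K α s.F) = 0) →
        ∀ i ∈ S, b i = 0) :
    ∃ (X' : Scheme.{0}) (π : X' ⟶ P 4 K) (M' : MarkedIdeal X'),
      IsMarkedResolution (⟨hypSheaf p s.F, [], p⟩ : MarkedIdeal (P 4 K)) π M' :=
  ⟨_, blowup.π (AffineCoordBlowup.𝓘Λ 4 K (insert 0 (Fin.succ '' (S : Set (Fin 4))))), _,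
    isMarkedResolution_transform_of_no_edge s hF hclean hS
      (blowup.isBlowup (AffineCoordBlowup.𝓘Λ 4 K (insert 0 (Fin.succ '' (S : Set (Fin 4)))))) hnoEdge hlocus⟩

/-- **Conversely, an edge obstructs the one-step resolution**: if the walk has an edge `s → s'` then the transformed
marked ideal has NON-EMPTY support (the point `chartImm_j (a, b)` of TY-3f `exists_point_of_edge`), so the single
blow-up is not a marked resolution. [cite: BierstoneGrigorievMilmanWlodarczyk2011, Def. 3.1.3 (6)] -/
theorem support_transform_nonempty_of_edge [IsAlgClosed K] (s s' : State K) (hS : IsPermissibleCentre p S s.F)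
    (hπ : IsBlowup π (AffineCoordBlowup.𝓘Λ 4 K (insert 0 (Fin.succ '' (S : Set (Fin 4)))))) (h : Edge p S s s') :
    (((⟨hypSheaf p s.F, [], p⟩ : MarkedIdeal (P 4 K)).transform π
        (AffineCoordBlowup.𝓘Λ 4 K (insert 0 (Fin.succ '' (S : Set (Fin 4)))))).support).Nonempty := by
  obtain ⟨j, hj, b, a, x, -, -, -, hord⟩ := exists_point_of_edge s s' hS hπ h
  exact ⟨_, hord⟩

end OneStep

end Equimultiple

end Summit.ResolutionOfSingularities.ResolutionOfSingularities.Theorems.PIDim4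

end
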